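/-
Copyright: the b2b-balaban cell (near-miss cell 7), T⁴-continuum fan-out; row NE7b CRUX team (2), seat
t4-ne7b-formalise-leaf-05 (gen 29) (S12-W crew; the OWNER's INTERFACE REQUEST NE7b IR-44-1 «THE END TWIN OVER THE
`κ := costT` WITNESS WITH THE SLACK SPLIT», `CLAIMS.log` l.30796, HOME/INBOX.md l.7662–7670; brick M-WV = the WEIGHTED
twin at `κ := costT` of leaf-03's `HistoryAssemblyMultTotal.card_mul_pshapeTH_le_priceT_total` (IR-42-2, T1′)).
Released under the licence of the surrounding project.
-/
import Summits.QuantumFields.BalabanUV.T4Continuum.Support.HistoryAssemblyMultTotal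
import Summits.QuantumFields.BalabanUV.T4Continuum.Support.HistoryBankingVolumePlug

/-!
# History assembly, multiplicity socket: the floor-level slack AT `κ := costT` WITH THE VOLUME REMAINDER's WEIGHTED
CLASS FACTOR (IR-44-1, brick M-WV)

Summits-side support leaf of the T⁴-continuum cell (rung (B)+1 on a FINITE torus only; NOT infinite volume, NOT the
mass gap, NOT the Clay statement; NOT a proof of the spine estimate NE7b, which is the cell's OWN estimate, NOT PRINTED
and NOT PROVED).  Row NE7b, route «COUNT», re-open object (α), row S20 «(α)-M5-2 THE WITNESS PLUG».

WHY.  On the floor Mult road of the S12-W work list (T1 `HistoryAssemblyRealiseRunMultWT` → W10T → W9T → E4T → E6T →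
E7T) the H3 realised-cost binder `hκ` (total form) and the slot multiplicity's class-linear factor `e^{θ·birthLinT}` are
consumed TOGETHER by ONE per-occupant step, `HistoryAssemblyMultTotal.card_mul_pshapeTH_le_priceT_total`.  The owner's
M5-2 (rows S19∕S20: `HistoryBankingVolumePlug` p263135, `B16HistoryWeightPlug` p264249,
`HistoryRealiseCellsRunApexT3bWTV` p263890) fixes the realised cost to the model's own booked cost (`κ := costT`, so `hκ`
is `le_rfl` and LEAVES) and supplies the live VOLUME factor inside `e^{+lifeCost (costT) q.2}` up to a WEIGHTED class
remainder `e^{birthWT Prod.fst (uᵥ K) q.2}` (`uᵥ K = 2^{d+3}·log Λ K`), to be paid from print's birth-credit room SPLIT as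
`C.a + (θ + θᵥ) ≤ ½γ₀A₁²` under the display `uᵥ K j ≤ θᵥ·p₀(g_K j)²` at the members' birth steps (INTERFACE REQUEST
IR-44-1; the owner's `hprice`-level socket is `HistoryAssemblyPrice.hprice_of_printed_slack_weighted_costT`).  THIS FILE is
the per-occupant step the END twin T1V (`HistoryAssemblyRealiseRunMultWTV`, IR-44-1 (2)) calls in `hoccOf` in place of
`card_mul_pshapeTH_le_priceT_total`: the price carries BOTH factors, NO realised-cost binder.
[folklore] arithmetic over the lineage's OWN price letters (`pshapeTH`, `priceT`, `shapeTH`, `birthLinT`, `birthWT`);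
nothing quoted from print, nothing printed asserted, no `[cite:]` tag, no definition, no `Prop` fact, zero `sorry`.

WHAT.  **`card_mul_pshapeTH_weighted_le_priceT_costT`**: binders of `card_mul_pshapeTH_le_priceT_total` with (i) `κ`,
`hκ` DROPPED (the price is read at `costT sh C K (R K)`), (ii) the slack SPLIT `hslack : C.a + (θ + θv) ≤ ½γ₀A₁²`, (iii)
the weight display `hu : ∀ e ∈ q.2.events, (sh e).kind = 0 → u (sh e).step ≤ θv·p₀(g K (sh e).step)²`, and the priced
factor `pshapeTH … (costT …) q.2 * Real.exp (birthWT sh u q.2) * Real.exp (−Ξ)`; conclusion `≤ priceT sh C Λ′ R g K q`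
identical.  **`card_mul_pshapeTH_le_priceT_costT`**: the `u ≡ 0` ∕ `θᵥ = 0` instance = the total lemma at `κ := costT`
(round trip, by name both ways in §2).

HONEST.  Bookkeeping; by-name effect NONE until the END twin consumes it; by-name class of every `WALL-NE7b-P1.md` §2
binder UNCHANGED; headline p224237 ∕ E7T ∕ the V-headline p263890 UNCHANGED BY NAME; NE7b NOT PRINTED ∕ NOT PROVED;
spine 0∕9.  HONEST DEPENDENCY (cell): continuum YM on T⁴ ⇐ BetaPertH ∧ nine spine estimates (0/9 proved); BetaPertH ⇐
(D1) ∧ (D4) ∧ CAP+tail; G-an2-4 gates asym, D1 and NE2/3/4.  This file changes none of it.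
-/

open Finset
open Literature.MathematicalPhysics.QuantumFieldTheory.Balaban1983to89
open T4PersistenceDictionary T4PersistentHistoryCount T4BankedInduction T4PrintedShapeBanking
open T4LiveClassFibration T4LiveStructureGas T4BranchingRecordsGas T4TaggedShapeBanking T4PartnerMultiplicity
open Summit.QuantumFields.BalabanUV.T4Continuum.LateMergers
open Summit.QuantumFields.BalabanUV.T4Continuum.HistorySocketTH
open Summit.QuantumFields.BalabanUV.T4Continuum.HistoryAssemblyTerms
open Summit.QuantumFields.BalabanUV.T4Continuum.HistoryAssemblyTermsLE
open Summit.QuantumFields.BalabanUV.T4Continuum.HistoryConstants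
open Summit.QuantumFields.BalabanUV.T4Continuum.HistoryAssemblyPrice
open Summit.QuantumFields.BalabanUV.T4Continuum.HistoryBankingLE
open Summit.QuantumFields.BalabanUV.T4Continuum.HistoryAssemblyMult
open Summit.QuantumFields.BalabanUV.T4Continuum.HistoryAssemblyMultTotal
open Summit.QuantumFields.BalabanUV.T4Continuum.HistoryBankingVolumePlug

namespace Summit.QuantumFields.BalabanUV.T4Continuum.HistoryAssemblyMultWeighted

noncomputable section

section Printed

variable {ε γ : Type*} [DecidableEq ε] {C : T4PrintedShapeBanking.Consts} {O : PrintedO1s}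

/-! ## §1 The per-occupant bound at `κ := costT` with both slack factors -/

/-- **THE FLOOR-LEVEL SLACK AT `κ := costT` WITH THE WEIGHTED CLASS FACTOR** (IR-44-1, brick M-WV): if the number `N` of
occupants of a member's slot is at most `e^{θ·birthLinT sh q.2 + Ξ}·Λm^{partnerAges}`, the profile is `≥ 1` and the
weight display `u_j ≤ θᵥ·p₀(g_K j)²` holds at the member's birth steps, `θ ≥ 0`, the room is SPLIT as
`C.a + (θ + θᵥ) ≤ ½γ₀A₁²`, and `Λm·Λr ≤ Λ′`, then `N` copies of the member's print-priced shape AT THE MODEL's OWN BOOKED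
COST, times the volume remainder's factor `e^{birthWT sh u q.2}`, discounted by `e^{−Ξ}`, fit under the model-currency
price `priceT sh C Λ′ R g K q`.  NO realised-cost binder. [folklore] -/
theorem card_mul_pshapeTH_weighted_le_priceT_costT (sh : ε → PEv) {θ θv Λm Λr Λ' : ℝ} (hθ : 0 ≤ θ)
    (hslack : C.a + (θ + θv) ≤ O.γ₀ * O.A₁ ^ 2 / 2) (hΛm : 0 ≤ Λm) (hΛr : 0 ≤ Λr) (hΛ : Λm * Λr ≤ Λ')
    (R : ℕ → ℕ → ℕ) (g : ℕ → ℕ → ℝ) (K : ℕ) {q : γ × Gen ε} {u : ℕ → ℝ} {N Ξ : ℝ}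
    (hP1 : ∀ e ∈ q.2.events, (sh e).kind = 0 → 1 ≤ p0Profile C.A₀ C.p₀ (g K (sh e).step))
    (hu : ∀ e ∈ q.2.events, (sh e).kind = 0 → u (sh e).step ≤ θv * p0Profile C.A₀ C.p₀ (g K (sh e).step) ^ 2)
    (hN : N ≤ Real.exp (θ * birthLinT sh q.2 + Ξ) * Λm ^ partnerAges (PEv.step ∘ sh) q.2) :
    N * (pshapeTH sh O C 1 Λr (R K) (g K) 0 (costT sh C K (R K)) q.2 * Real.exp (birthWT sh u q.2) *
        Real.exp (-Ξ)) ≤ priceT sh C Λ' R g K q := by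
  have hps : 0 ≤ pshapeTH sh O C 1 Λr (R K) (g K) 0 (costT sh C K (R K)) q.2 :=
    pshapeTH_nonneg sh zero_le_one hΛr _ _ _ _ _
  have hB := Real.exp_pos (birthWT sh u q.2)
  -- the slot multiplicity
  have h1 : N * (pshapeTH sh O C 1 Λr (R K) (g K) 0 (costT sh C K (R K)) q.2 * Real.exp (birthWT sh u q.2) *
        Real.exp (-Ξ)) ≤
      Real.exp (θ * birthLinT sh q.2 + Ξ) * Λm ^ partnerAges (PEv.step ∘ sh) q.2 *
        (pshapeTH sh O C 1 Λr (R K) (g K) 0 (costT sh C K (R K)) q.2 * Real.exp (birthWT sh u q.2) *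
          Real.exp (-Ξ)) :=
    mul_le_mul_of_nonneg_right hN (mul_nonneg (mul_nonneg hps hB.le) (Real.exp_pos _).le)
  -- the allowance `Ξ` cancels; regroup
  have h2 : Real.exp (θ * birthLinT sh q.2 + Ξ) * Λm ^ partnerAges (PEv.step ∘ sh) q.2 *
        (pshapeTH sh O C 1 Λr (R K) (g K) 0 (costT sh C K (R K)) q.2 * Real.exp (birthWT sh u q.2) *
          Real.exp (-Ξ)) =
      Λm ^ partnerAges (PEv.step ∘ sh) q.2 *
        (pshapeTH sh O C 1 Λr (R K) (g K) 0 (costT sh C K (R K)) q.2 * Real.exp (θ * birthLinT sh q.2) *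
          Real.exp (birthWT sh u q.2)) := by
    have e : Real.exp (θ * birthLinT sh q.2 + Ξ) * Real.exp (-Ξ) = Real.exp (θ * birthLinT sh q.2) := by
      rw [← Real.exp_add, add_neg_cancel_right]
    calc _ = Λm ^ partnerAges (PEv.step ∘ sh) q.2 *
          (pshapeTH sh O C 1 Λr (R K) (g K) 0 (costT sh C K (R K)) q.2 *
            (Real.exp (θ * birthLinT sh q.2 + Ξ) * Real.exp (-Ξ)) * Real.exp (birthWT sh u q.2)) := by ring
      _ = _ := by rw [e]
  -- the merged weight display `θ + u_j ≤ (θ + θᵥ)·p₀²` (profile floor for the class-linear share, `hu` for the rest)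
  have hw : ∀ e ∈ q.2.events, (sh e).kind = 0 →
      θ + u (sh e).step ≤ (θ + θv) * p0Profile C.A₀ C.p₀ (g K (sh e).step) ^ 2 := fun e he h0 => by
    have h1' := hP1 e he h0
    have hsq : 1 ≤ p0Profile C.A₀ C.p₀ (g K (sh e).step) ^ 2 := by nlinarith
    nlinarith [hu e he h0, mul_le_mul_of_nonneg_left hsq hθ]
  -- the per-member step AT `κ := costT` with BOTH factors (the owner's weighted slack lemma, `h := le_rfl`)
  have h3 : pshapeTH sh O C 1 Λr (R K) (g K) 0 (costT sh C K (R K)) q.2 * Real.exp (θ * birthLinT sh q.2) *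
        Real.exp (birthWT sh u q.2) ≤ HistoryConstants.shapeTH sh C 1 Λr (R K) (g K) K 0 q.2 := by
    rw [mul_assoc, exp_mul_exp_eq_exp_birthWT]
    exact pshapeTH_mul_exp_le_shapeTH_of_weighted sh hslack zero_le_one hΛr (R K) (g K) K 0 hw (fun _ _ => le_rfl)
  -- the TH exit's shape at `Λr`, times `Λm^{partnerAges}`, under the model-currency price at `Λ′ ≥ Λm·Λr`
  have hE : 0 ≤ Real.exp (-credits (credit C (g K) ∘ sh) q.2) *
      Real.exp (lifeCost (dictWT sh (R K) C.n₁) (costT sh C K (R K)) q.2) := by positivity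
  have h4 : Λm ^ partnerAges (PEv.step ∘ sh) q.2 * HistoryConstants.shapeTH sh C 1 Λr (R K) (g K) K 0 q.2 ≤
      priceT sh C Λ' R g K q := by
    rw [shapeTH_zero_one, priceT, ← mul_assoc, ← mul_pow]
    exact mul_le_mul_of_nonneg_right (pow_le_pow_left₀ (mul_nonneg hΛm hΛr) hΛ _) hE
  calc _ ≤ _ := h1
    _ = _ := h2
    _ ≤ Λm ^ partnerAges (PEv.step ∘ sh) q.2 * HistoryConstants.shapeTH sh C 1 Λr (R K) (g K) K 0 q.2 :=
      mul_le_mul_of_nonneg_left h3 (pow_nonneg hΛm _)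
    _ ≤ _ := h4

/-! ## §2 The `u ≡ 0` instance: the total lemma at `κ := costT` (round trip, by name both ways) -/

/-- **AT ZERO WEIGHT THE WEIGHTED BRICK IS THE TOTAL LEMMA AT `κ := costT`**: `birthWT sh 0 G = 0`, so the weighted
factor is `1` and the room needs no split (`θᵥ = 0`). [folklore] -/
theorem card_mul_pshapeTH_le_priceT_costT (sh : ε → PEv) {θ Λm Λr Λ' : ℝ} (hθ : 0 ≤ θ)
    (hslack : C.a + θ ≤ O.γ₀ * O.A₁ ^ 2 / 2) (hΛm : 0 ≤ Λm) (hΛr : 0 ≤ Λr) (hΛ : Λm * Λr ≤ Λ')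
    (R : ℕ → ℕ → ℕ) (g : ℕ → ℕ → ℝ) (K : ℕ) {q : γ × Gen ε} {N Ξ : ℝ}
    (hP1 : ∀ e ∈ q.2.events, (sh e).kind = 0 → 1 ≤ p0Profile C.A₀ C.p₀ (g K (sh e).step))
    (hN : N ≤ Real.exp (θ * birthLinT sh q.2 + Ξ) * Λm ^ partnerAges (PEv.step ∘ sh) q.2) :
    N * (pshapeTH sh O C 1 Λr (R K) (g K) 0 (costT sh C K (R K)) q.2 * Real.exp (-Ξ)) ≤
      priceT sh C Λ' R g K q := by
  have h0 : birthWT sh (fun _ => (0 : ℝ)) q.2 = 0 := by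
    rw [← mul_birthLinT_eq_birthWT, zero_mul]
  have h := card_mul_pshapeTH_weighted_le_priceT_costT sh (θv := 0) (u := fun _ => 0) hθ (by simpa using hslack)
    hΛm hΛr hΛ R g K hP1 (fun e _ _ => by positivity) hN (Ξ := Ξ)
  rwa [h0, Real.exp_zero, mul_one] at h

/-- round trip: the `κ := costT` instance of the landed TOTAL lemma is §2's statement (binders and conclusion
LITERALLY those of `card_mul_pshapeTH_le_priceT_costT`; kernel-checked both ways). [folklore] -/
example (sh : ε → PEv) {θ Λm Λr Λ' : ℝ} (hθ : 0 ≤ θ)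
    (hslack : C.a + θ ≤ O.γ₀ * O.A₁ ^ 2 / 2) (hΛm : 0 ≤ Λm) (hΛr : 0 ≤ Λr) (hΛ : Λm * Λr ≤ Λ')
    (R : ℕ → ℕ → ℕ) (g : ℕ → ℕ → ℝ) (K : ℕ) {q : γ × Gen ε} {N Ξ : ℝ}
    (hP1 : ∀ e ∈ q.2.events, (sh e).kind = 0 → 1 ≤ p0Profile C.A₀ C.p₀ (g K (sh e).step))
    (hN : N ≤ Real.exp (θ * birthLinT sh q.2 + Ξ) * Λm ^ partnerAges (PEv.step ∘ sh) q.2) :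
    N * (pshapeTH sh O C 1 Λr (R K) (g K) 0 (costT sh C K (R K)) q.2 * Real.exp (-Ξ)) ≤
      priceT sh C Λ' R g K q :=
  card_mul_pshapeTH_le_priceT_total sh hθ hslack hΛm hΛr hΛ R g K hP1 le_rfl hN

end Printed

end

end Summit.QuantumFields.BalabanUV.T4Continuum.HistoryAssemblyMultWeighted
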